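import Summits.AtomisticToContinuum.Crystallization.Theorems.FreeSplittingCertificatesStrictSplittingRuleP1TableDecay

/-!
# `StrictSplittingRule` (stmt-AtomisticToContinuum-12560): THE RECEIPTS TRANSFER IN TABLE FORM — one statement for the assembly (P1 interpolant object, part 19)

Route `FreeSplittingCertificates`, crux r3 `StrictSplittingRule` (H12⋆ = `stub_coreJointCoercive`), unit b2b-freesplit-B gen 22.
VALUE = item (2'') of HOME FAR-LEMMA-SPEC §16 (c), RECEIPTS SIDE, assembled into the single statement the H12⋆ assembly consumes
(parts 13–18 combined): at ANY site `p` (either parity), for the re-based far-ledger field `ṽ(x) = v(y_p + x)` of ANY finitely supported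
lattice displacement minus any affine field (`v = p1Disp a h U b₀ A`), the split weight `χ = fpChi R₁² R₂²` (`0 < R₁ < R₂`), on the hcp
ratio box `81619/100000·a ≤ h ≤ 81657/100000·a`:
`a⁴ · ∫ χ(x)²·Den(x, ∇ṽ(x)) dx ≤ Σ'_q Σ_{d ∈ p1BondOffsets} p1RecTable (p1Par q) (p − q) d · ⟪y_{q+d} − y_q, v(q+d) − v(q)⟫²`
with a COVARIANT (`p1BondW_p1SiteW_eq_p1RecTable`), nonnegative, `(1+r)⁻⁶`-DECAYING (`p1RecTable_fpChi_decay`) table supported on the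
finite bond set `p1BondOffsets` — i.e. the receipts `t·∫χ²Den` on the right of the far inequality
`farPencil4_weighted_integral_le_p1Disp_translate` are paid by second-order transfer tables of exactly the kind `CoreJointCoercive`
quantifies over (diagonal, `M b e d d = −(t/a⁴)·p1RecTable b e d`).  What remains of the transfer is the DEMAND side (readout and bare
terms: lattice point values/differences bounded above by the inflated continuum demand `∫χ²N`).  NOT a proof of H12⋆, NOT summit
progress.  [folklore]
-/

noncomputable section

open Set Function Metric MeasureTheory Filter Topology
open scoped BigOperators NNReal ENNReal

namespace Summit.AtomisticToContinuum.Crystallization.Theorems.StrictSplittingRuleBirth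

open Literature.MathematicalPhysics.StatisticalMechanics
open Summit.AtomisticToContinuum.Crystallization.Theorems.PalmUnimodularRigidity.LayeredLawsSelectHcp

/-- The split-weight density centred at the origin: `g(z) = χ(z)²·|z|⁻⁶`, `χ = fpChi R₁² R₂²`. -/
def p1SplitDensity (R1 R2 : ℝ) (z : Fin 3 → ℝ) : ℝ :=
  fpChi (R1 ^ 2) (R2 ^ 2) z ^ 2 * (fpSq z)⁻¹ ^ 3

/-- The split-weight density is nonnegative. -/
theorem p1SplitDensity_nonneg (R1 R2 : ℝ) (z : Fin 3 → ℝ) : 0 ≤ p1SplitDensity R1 R2 z :=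
  mul_nonneg (sq_nonneg _) (pow_nonneg (inv_nonneg.2 (fpSq_nonneg _)) _)

/-- **Decay of the matched receipts table** in `CoreJointCoercive`'s format: `∃ C, ∀ p q d, |p1RecTable (p1Par q) (p − q) d| ≤
C·((1 + ‖y_q − y_p‖)⁻¹)⁶` for the split weight.  NOT a proof of H12⋆, NOT summit progress. -/
theorem p1RecTable_fpChi_decay {a h : ℝ} (ha : 0 < a) (hh : 0 < h) {R1 R2 : ℝ} (hR1 : 0 < R1) (hR12 : R1 < R2) :
    ∃ C : ℝ, ∀ p q d : ℤ × ℤ × ℤ, 0 ≤ p1RecTable a h (p1SplitDensity R1 R2) (p1Par q) (p - q) d ∧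
      |p1RecTable a h (p1SplitDensity R1 R2) (p1Par q) (p - q) d| ≤ C * ((1 + ‖hcpSite a h q - hcpSite a h p‖)⁻¹) ^ 6 := by
  have h1 : 0 < R1 ^ 2 := by positivity
  have hlt : R1 ^ 2 < R2 ^ 2 := by nlinarith
  obtain ⟨C, hC⟩ := p1BondW_p1SiteW_decay ha hh (g := p1SplitDensity R1 R2) (by norm_num : (0 : ℝ) ≤ 8) h1
    (fun z => chiSq_invPow_le h1 hlt z) (p1SplitDensity_nonneg R1 R2)
  refine ⟨C, fun p q d => ?_⟩
  have h := hC p q d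
  rw [← p1BondW_p1SiteW_eq_p1RecTable ha.ne' hh.ne']
  exact ⟨h.1, by rw [abs_of_nonneg h.1]; exact h.2⟩

/-- **THE RECEIPTS TRANSFER IN TABLE FORM (the statement the assembly consumes).**  At any site `p`, for the re-based far-ledger field
`ṽ(x) = v(y_p + x)`, `v = p1Disp a h U b₀ A` (`U` finitely supported), the split weight `χ = fpChi R₁² R₂²` and the hcp ratio box:
`a⁴·∫χ²Den(∇ṽ) ≤ Σ'_q Σ_{d ∈ p1BondOffsets} p1RecTable (p1Par q) (p − q) d · str(q, q+d)²`, the bond family being summable.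
NOT a proof of H12⋆, NOT summit progress. -/
theorem farReceipts_le_tsum_table {a h : ℝ} (ha : 0 < a) (hlo : 81619 / 100000 * a ≤ h) (hhi : h ≤ 81657 / 100000 * a)
    (U : ℤ × ℤ × ℤ → (Fin 3 → ℝ)) (hU : (support U).Finite) (b₀ : Fin 3 → ℝ) (A : Fin 3 → Fin 3 → ℝ) (p : ℤ × ℤ × ℤ)
    {R1 R2 : ℝ} (hR1 : 0 < R1) (hR12 : R1 < R2) :
    Summable (fun q => ∑ d ∈ p1BondOffsets,
      p1RecTable a h (p1SplitDensity R1 R2) (p1Par q) (p - q) d * p1Str a h U b₀ A q (q + d) ^ 2) ∧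
    a ^ 4 * ∫ x, fpChi (R1 ^ 2) (R2 ^ 2) x ^ 2 *
        fpDen x (fpGrad (fun y => p1Disp a h U b₀ A ((fun k => hcpSite a h p k) + y)) x) ≤
      ∑' q, ∑ d ∈ p1BondOffsets, p1RecTable a h (p1SplitDensity R1 R2) (p1Par q) (p - q) d * p1Str a h U b₀ A q (q + d) ^ 2 := by
  have ha' : a ≠ 0 := ha.ne'
  have hh' : h ≠ 0 := by intro h0; rw [h0] at hlo; linarith
  have h1 : 0 < R1 ^ 2 := by positivity
  have hlt : R1 ^ 2 < R2 ^ 2 := by nlinarith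
  have hR2 : 0 ≤ R2 := by linarith
  obtain ⟨hs, hle⟩ := integral_chiSq_fpDen_translate_le_tsum ha hlo hhi U hU (fun k => hcpSite a h p k) b₀ A
    (contDiff_two_fpChi (R1 ^ 2) (R2 ^ 2)) (zero_notMem_tsupport_fpChi h1 hlt)
    (fun y hy => fpChi_eq_one_of_norm_ge hlt hR2 le_rfl y hy)
  -- the cell weights there are the site-centred split-density weights
  have hWeq : (fun i => ∫ y in p1RealCell a h i, fpChi (R1 ^ 2) (R2 ^ 2) (y - fun k => hcpSite a h p k) ^ 2 *
      (fpSq (y - fun k => hcpSite a h p k))⁻¹ ^ 3) = p1SiteW a h (p1SplitDensity R1 R2) p := by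
    funext i; rfl
  rw [hWeq] at hs hle
  have hW : ∀ i, 0 ≤ p1SiteW a h (p1SplitDensity R1 R2) p i := p1SiteW_nonneg a h (p1SplitDensity_nonneg R1 R2) p
  obtain ⟨hr, e⟩ := tsum_p1CubeRec_eq_tsum_bond a h U b₀ A hW hs
  have htab : ∀ q d, p1BondW (p1SiteW a h (p1SplitDensity R1 R2) p) q d = p1RecTable a h (p1SplitDensity R1 R2) (p1Par q) (p - q) d :=
    fun q d => p1BondW_p1SiteW_eq_p1RecTable ha' hh' _ p q d
  simp only [htab] at hr e
  exact ⟨hr, hle.trans e.le⟩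

end Summit.AtomisticToContinuum.Crystallization.Theorems.StrictSplittingRuleBirth
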